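/-
Copyright (c) 2026 the pub-hodgecm-mathlib formalisation cell (harness21).  Prover seat hodgecm-mathlib-A-p17 (g26), P6 «MOD programme»,
organ (ν6) of the G1c «ROOF REDUCTION» remainder; 2026-09-01.
-/
import Literature.AlgebraicGeometry.AbelianSchemes.AbelianSchemeFibreAlongFiniteStage
import Literature.AlgebraicGeometry.AbelianSchemes.AbelianSchemeHomDescendExtendStage
import Literature.AlgebraicGeometry.AbelianSchemes.AbelianSchemeHomExtensionFromDedekindStage
import HarnessLib

/-!
# REDUCTION OF A HOMOMORPHISM between the fibre tuples at two `Ω`-points of a proper model, along a finite Dedekind stage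
# ([SerreTate1968] §1; [BoschLutkebohmertRaynaud1990] §1.2 Prop. 8, §7.3 Prop. 6; [EGAIV3] 8.8.2; [MumfordFogartyKirwan1994] Ch. 7 §2)

Topic `AlgebraicGeometry/AbelianSchemes`, namespace `Literature.AlgebraicGeometry.AbelianSchemes.AbelianSchemeOver`.  THEOREMS ONLY
(no definition, no named fact, no instance, no notation, no `sorry`).  Cell `hodgecm-mathlib` (D-0151), F0∕P6 «MOD», organ **(ν6)** —
THE INTEGRAL-MODEL HEAD of the (ν) chain (A-p17 (g26) FINDING «G1c BASE IS NOT DEDEKIND», 2026-09-01): it composes ★ (ν4)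
(`AbelianSchemeFibreAlongFiniteStage`: tuples at `x` ∕ `red_𝓨 x` = fibres of `𝒜_z` over the stage) with ★ (ν5)
(`AbelianSchemeHomDescendExtendStage.exists_finiteStage_hom_extension`: descend-and-extend over a finite refinement of the stage) into
ONE statement in the currency of the P6a datum (`fibreΩOf` ∕ `fibre₀Of` are these fibres), so that the σ-pens of `stub_HFROB` reduce an
`Ω`-roof leg ∕ `Ω`-isogeny `u` between the tuples at two generic points `x, x″` to a homomorphism ∕ isogeny between the tuples at
`red_𝓨 x, red_𝓨 x″` in three moves: (ν4) §2 `exists_finiteStage_comp_eq_pair` (ONE finite stage `D` for both integral points), THIS head,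
then `ū := (E_s 𝒜)⁻¹ ≫ U_{t′} ≫ (E_s″ 𝒞)` with the special along-stage isomorphisms of §1 at the `κ̄`-point `t′` supplied below.

## Contents

* §1 (ANY base `T`; `j : U → T`, `z : V → T`, `g : V′ → V`, field points `y`, `a`, `a′` with `y ≫ j = a ≫ z`, `a′ ≫ g = a`) — the FIVE-PIECE
  ALONG-STAGE ISOMORPHISM `E 𝒜 : ((𝒜 ×_T U)_y) ≅ (((𝒜 ×_T V) ×_V V′)_{a′})` (★ `fibreBaseChangeIso` ≪≫ ★ `fibreCongrPtIso` ≪≫ ★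
  `fibreBaseChangeIso⁻¹` ≪≫ ★ `fibreCongrPtIso⁻¹` ≪≫ ★ `fibreBaseChangeIso⁻¹`) is NATURAL in the abelian scheme
  (`fibreHom_comp_alongStageIso_hom`, for every homomorphism `f : 𝒜 → ℬ` over `T`: `ι(a)`, `λ`, …) and carries pulled-back SECTIONS to
  pulled-back sections (`map_alongStageIso_restrictPt`) — stated for the literal composite, so it applies to BOTH the generic instance
  (`j = ι_η`, `y = x`, `a = Spec Ω → Spec R → Spec D`) and the special instance (`j = ι_s`, `y = red_𝓨 x`, `a = Spec κ̄ → Spec R → Spec D`).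
* §2 **`exists_stage_hom_reduction`** — for a proper model `𝓨` of `Y` at `v`, abelian schemes `𝒜, 𝒞 → 𝓨`, points `x, x″ ∈ Y(Ω)`, a
  Dedekind stage `g : 𝓞ᵥ → D`, `h : D → R = 𝒪_{Ω̄}` (fraction field `L` perfect, `Ω ⊇ L` algebraic; `hh`, `ha`) through which BOTH integral
  points factor (`z, z″ : Spec D → 𝓨`, `hz`, `hz″` — ★ (ν4) `exists_finiteStage_comp_eq_pair` + ★ (ν1) §4 + ★ (ν3) §4 supply all of this
  for `D = integralClosure 𝒪[K_v] L`), and a homomorphism `u` of abelian varieties over `Ω` between the fibre of `𝒜|_Y` at `x` and the fibre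
  of `𝒞|_Y` at `x″`: there are a finite refinement `D′ = integralClosure D L′ → R` (Dedekind, `h′ ∘ (D → D′) = h`) and a HOMOMORPHISM
  `U : (𝒜_z)_{D′} → (𝒞_{z″})_{D′}` of abelian schemes over `Spec D′` with **`U_{a′} = (E 𝒜)⁻¹ ≫ u ≫ (E″ 𝒞)`** for the generic along-stage
  isomorphisms of §1 (point equalities `hpt`, `hpt″`, `e` supplied), UNIQUE with this `Ω`-fibre, and with EVERY fibre over `Spec D′` an
  isogeny when `u` is; the special point equalities `hspt`, `hspt″`, `et` for the §1 isomorphisms at `red_𝓨 x`, `red_𝓨 x″` are supplied too.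

HONEST LABEL: HC_CM is proved only modulo the cell's 2 remaining named inputs (hLiu418 24832, h413 24833) until rung 0 closes; generic capital on
`--supports stmt-HodgeConjecture-24832`, pays no letter.

## References
* [SerreTate1968] J.-P. Serre, J. Tate, *Good reduction of abelian varieties*, Ann. of Math. 88 (1968), §1 (reduction of homomorphisms).
* [BoschLutkebohmertRaynaud1990] S. Bosch, W. Lütkebohmert, M. Raynaud, *Néron Models* (1990), §1.2 Prop. 8, §7.3 Prop. 6.
* [EGAIV3] A. Grothendieck, J. Dieudonné, EGA IV₃ (1966), Thm. 8.8.2 (i).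
* [MumfordFogartyKirwan1994] D. Mumford, J. Fogarty, F. Kirwan, *GIT*, 3rd ed., Ch. 7 §2 Def. 7.2 (p. 129).
* [GortzWedhorn2020] U. Görtz, T. Wedhorn, *Algebraic Geometry I*, 2nd ed., Section (4.7), Prop. 4.16.
-/

set_option autoImplicit false

noncomputable section

set_option backward.isDefEq.respectTransparency false

universe u

open CategoryTheory CategoryTheory.Limits AlgebraicGeometry
open scoped MonObj CategoryTheory.Obj
open Literature.AlgebraicGeometry.Motives (AbelianVariety AlgPoints)

namespace Literature.AlgebraicGeometry.AbelianSchemes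
namespace AbelianSchemeOver

/-! ## §1 The five-piece along-stage isomorphism: naturality and sections -/

section AlongStage

variable {T U V V' : Scheme.{u}} {Ω : Type u} [Field Ω]
  (j : U ⟶ T) (z : V ⟶ T) (g : V' ⟶ V) (y : Spec (.of Ω) ⟶ U) (a : Spec (.of Ω) ⟶ V) (a' : Spec (.of Ω) ⟶ V')
  (hpt : y ≫ j = a ≫ z) (e : a' ≫ g = a)

/-- For an isomorphism of abelian varieties carrying `P` to `Q`, the inverse carries `Q` to `P`. [folklore] -/
private theorem alongStage_map_inv_eq_of_map_hom_eq {K : Type u} [Field K] {X Y : AbelianVariety K} (φ : X ≅ Y) {L : Type u} [Field L]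
    [Algebra K L] {P : AlgPoints X.X L} {Q : AlgPoints Y.X L} (hPQ : AlgPoints.map φ.hom.hom.hom.hom P = Q) :
    AlgPoints.map φ.inv.hom.hom.hom Q = P := by
  rw [← hPQ]
  change (P ≫ φ.hom.hom.hom.hom) ≫ φ.inv.hom.hom.hom = P
  have hφ : φ.hom.hom.hom.hom ≫ φ.inv.hom.hom.hom = 𝟙 _ := congrArg (fun ψ => ψ.hom.hom.hom) φ.hom_inv_id
  rw [Category.assoc, hφ, Category.comp_id]

/-- **The five-piece along-stage isomorphism is NATURAL in the abelian scheme**: for a homomorphism `f : 𝒜 → ℬ` over `T`,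
`(f ×_T U)_y ≫ E_ℬ = E_𝒜 ≫ ((f ×_T V) ×_V V′)_{a′}` (★ naturality of `fibreBaseChangeIso` (d4) and of `fibreCongrPtIso` (d2), five times).
[cite: MumfordFogartyKirwan1994, Ch. 7 §2 Definition 7.2 (p. 129)] [cite: GortzWedhorn2020, Section (4.7), Prop. 4.16] -/
theorem fibreHom_comp_alongStageIso_hom (𝒜 ℬ : AbelianSchemeOver T) (f : 𝒜.X ⟶ ℬ.X) [IsMonHom f] :
    haveI := isMonHom_baseChangeHom f j
    haveI := isMonHom_baseChangeHom f z
    haveI := isMonHom_baseChangeHom (baseChangeHom f z) g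
    fibreHom (baseChangeHom f j) y ≫
        (ℬ.fibreBaseChangeIso j y ≪≫ ℬ.fibreCongrPtIso hpt ≪≫ (ℬ.fibreBaseChangeIso z a).symm ≪≫
          ((ℬ.baseChange z).fibreCongrPtIso e).symm ≪≫ ((ℬ.baseChange z).fibreBaseChangeIso g a').symm).hom =
      (𝒜.fibreBaseChangeIso j y ≪≫ 𝒜.fibreCongrPtIso hpt ≪≫ (𝒜.fibreBaseChangeIso z a).symm ≪≫
          ((𝒜.baseChange z).fibreCongrPtIso e).symm ≪≫ ((𝒜.baseChange z).fibreBaseChangeIso g a').symm).hom ≫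
        fibreHom (baseChangeHom (baseChangeHom f z) g) a' := by
  haveI := isMonHom_baseChangeHom f j
  haveI := isMonHom_baseChangeHom f z
  haveI := isMonHom_baseChangeHom (baseChangeHom f z) g
  simp only [Iso.trans_hom, Iso.symm_hom, Category.assoc]
  rw [← Category.assoc, fibreHom_baseChangeHom_comp_fibreBaseChangeIso_hom, Category.assoc,
    ← Category.assoc (fibreHom f _), fibreHom_comp_fibreCongrPtIso_hom, Category.assoc,
    ← Category.assoc (fibreHom f _), fibreHom_comp_fibreBaseChangeIso_inv, Category.assoc,
    ← Category.assoc (fibreHom (baseChangeHom f z) _)]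
  -- the `fibreCongrPtIso e` on `𝒜.baseChange z`, inverse form
  have hc : fibreHom (baseChangeHom f z) a ≫ ((ℬ.baseChange z).fibreCongrPtIso e).inv =
      ((𝒜.baseChange z).fibreCongrPtIso e).inv ≫ fibreHom (baseChangeHom f z) (a' ≫ g) := by
    rw [Iso.comp_inv_eq, Category.assoc, Iso.eq_inv_comp, fibreHom_comp_fibreCongrPtIso_hom]
  rw [hc, Category.assoc, fibreHom_comp_fibreBaseChangeIso_inv]

/-- **The five-piece along-stage isomorphism carries pulled-back sections to pulled-back sections**: the value at `y` of `τ ×_T U` goes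
to the value at `a′` of `(τ ×_T V) ×_V V′` (★ `map_fibreBaseChangeIso_restrictPt_sectionBaseChange`, ★ `map_fibreCongrPtIso_restrictPt`).
[cite: MumfordFogartyKirwan1994, Ch. 7 §2 Definition 7.1 and Definition 7.2 (p. 129)] -/
theorem map_alongStageIso_restrictPt (𝒜 : AbelianSchemeOver T) (τ : 𝒜.Sections) :
    AlgPoints.map (𝒜.fibreBaseChangeIso j y ≪≫ 𝒜.fibreCongrPtIso hpt ≪≫ (𝒜.fibreBaseChangeIso z a).symm ≪≫
          ((𝒜.baseChange z).fibreCongrPtIso e).symm ≪≫ ((𝒜.baseChange z).fibreBaseChangeIso g a').symm).hom.hom.hom.hom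
        ((𝒜.baseChange j).restrictPt y (𝒜.sectionBaseChange j τ)) =
      ((𝒜.baseChange z).baseChange g).restrictPt a' ((𝒜.baseChange z).sectionBaseChange g (𝒜.sectionBaseChange z τ)) := by
  have h1 := 𝒜.map_fibreBaseChangeIso_restrictPt_sectionBaseChange j y τ
  have h2 := 𝒜.map_fibreCongrPtIso_restrictPt hpt τ
  have h3 : AlgPoints.map (𝒜.fibreBaseChangeIso z a).inv.hom.hom.hom (𝒜.restrictPt (a ≫ z) τ) =
      (𝒜.baseChange z).restrictPt a (𝒜.sectionBaseChange z τ) :=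
    alongStage_map_inv_eq_of_map_hom_eq _ (𝒜.map_fibreBaseChangeIso_restrictPt_sectionBaseChange z a τ)
  have h4 : AlgPoints.map ((𝒜.baseChange z).fibreCongrPtIso e).inv.hom.hom.hom ((𝒜.baseChange z).restrictPt a (𝒜.sectionBaseChange z τ)) =
      (𝒜.baseChange z).restrictPt (a' ≫ g) (𝒜.sectionBaseChange z τ) :=
    alongStage_map_inv_eq_of_map_hom_eq _ ((𝒜.baseChange z).map_fibreCongrPtIso_restrictPt e (𝒜.sectionBaseChange z τ))
  have h5 : AlgPoints.map ((𝒜.baseChange z).fibreBaseChangeIso g a').inv.hom.hom.hom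
        ((𝒜.baseChange z).restrictPt (a' ≫ g) (𝒜.sectionBaseChange z τ)) =
      ((𝒜.baseChange z).baseChange g).restrictPt a' ((𝒜.baseChange z).sectionBaseChange g (𝒜.sectionBaseChange z τ)) :=
    alongStage_map_inv_eq_of_map_hom_eq _ ((𝒜.baseChange z).map_fibreBaseChangeIso_restrictPt_sectionBaseChange g a' (𝒜.sectionBaseChange z τ))
  calc AlgPoints.map (𝒜.fibreBaseChangeIso j y ≪≫ 𝒜.fibreCongrPtIso hpt ≪≫ (𝒜.fibreBaseChangeIso z a).symm ≪≫
          ((𝒜.baseChange z).fibreCongrPtIso e).symm ≪≫ ((𝒜.baseChange z).fibreBaseChangeIso g a').symm).hom.hom.hom.hom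
        ((𝒜.baseChange j).restrictPt y (𝒜.sectionBaseChange j τ))
      = AlgPoints.map ((𝒜.baseChange z).fibreBaseChangeIso g a').inv.hom.hom.hom
          (AlgPoints.map ((𝒜.baseChange z).fibreCongrPtIso e).inv.hom.hom.hom
            (AlgPoints.map (𝒜.fibreBaseChangeIso z a).inv.hom.hom.hom
              (AlgPoints.map (𝒜.fibreCongrPtIso hpt).hom.hom.hom.hom
                (AlgPoints.map (𝒜.fibreBaseChangeIso j y).hom.hom.hom.hom
                  ((𝒜.baseChange j).restrictPt y (𝒜.sectionBaseChange j τ)))))) := by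
          simp only [AlgPoints.map_apply, Iso.trans_hom, Iso.symm_hom, AbelianVariety.comp_hom, Category.assoc]
          rfl
    _ = _ := by rw [h1, h2, h3, h4, h5]

end AlongStage

/-! ## §2 The integral-model head -/

section Head

open Literature.AlgebraicGeometry.Motives IsDedekindDomain IsDedekindDomain.HeightOneSpectrum
open scoped NumberField
open Literature.NumberTheory.EllipticCurves (genericFibre specGenericPoint)
open Literature.NumberTheory.GaloisRepresentations (closureValuationSubring)
open Literature.NumberTheory.DiophantineGeometry

variable {K : Type} [Field K] [NumberField K] {v : HeightOneSpectrum (𝓞 K)} {Y : SchemeOver K}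
  (𝓨 : IntegralModel (valuationSubringAtPrime K v) K Y) [IsProper 𝓨.total.hom]
  (𝒜 𝒞 : AbelianSchemeOver 𝓨.total.left) (x x'' : AlgPoints Y (AlgebraicClosure (v.adicCompletion K)))
  {D : Type} [CommRing D] [IsDedekindDomain D] {L : Type} [Field L] [Algebra D L] [IsFractionRing D L] [PerfectField L]
  [Algebra L (AlgebraicClosure (v.adicCompletion K))] [Algebra.IsAlgebraic L (AlgebraicClosure (v.adicCompletion K))]
  (g : valuationSubringAtPrime K v →+* D) (h : D →+* closureValuationSubring (v.adicCompletion K))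
  (hh : ∀ d, ((h d : closureValuationSubring (v.adicCompletion K)) : AlgebraicClosure (v.adicCompletion K)) =
    algebraMap L (AlgebraicClosure (v.adicCompletion K)) (algebraMap D L d))
  (ha : Spec.map (CommRingCat.ofHom (algebraMap L (AlgebraicClosure (v.adicCompletion K)))) ≫ specGenericPoint D L =
    specGenericPoint (closureValuationSubring (v.adicCompletion K)) (AlgebraicClosure (v.adicCompletion K)) ≫
      Spec.map (CommRingCat.ofHom h))
  (z z'' : Over.mk (Spec.map (CommRingCat.ofHom g)) ⟶ 𝓨.total)
  (hz : Spec.map (CommRingCat.ofHom h) ≫ z.left =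
    (extendPoint (closureValuationSubring (v.adicCompletion K)) (toClosureValuationSubring v) 𝓨.total (𝓨.modelPointsEquiv.symm x)).left)
  (hz'' : Spec.map (CommRingCat.ofHom h) ≫ z''.left =
    (extendPoint (closureValuationSubring (v.adicCompletion K)) (toClosureValuationSubring v) 𝓨.total (𝓨.modelPointsEquiv.symm x'')).left)

include hh ha hz hz'' in
/-- **REDUCTION OF A HOMOMORPHISM BETWEEN FIBRE TUPLES AT TWO `Ω`-POINTS, ALONG A FINITE DEDEKIND STAGE.**  `𝓨` a proper model of `Y` at `v`,
`𝒜, 𝒞` abelian schemes over `𝓨`, `x, x″ ∈ Y(Ω)`; a Dedekind stage `g : 𝓞ᵥ → D`, `h : D → R = 𝒪_{Ω̄}` (`L = Frac D` perfect, `Ω ⊇ L`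
algebraic, `hh`, `ha`) with stage points `z, z″ : Spec D → 𝓨` UNDER the two integral points (`hz`, `hz″`); `u` a homomorphism of abelian
varieties over `Ω` from the fibre of `𝒜|_Y` at `x` to the fibre of `𝒞|_Y` at `x″`.  THEN: a finite field stage `L′ ⊇ L` (`χ` injective),
`h′ : D′ = integralClosure D L′ → R` over `h` (`D′` Dedekind, `Frac D′ = L′`), a HOMOMORPHISM `U : (𝒜_z)_{D′} → (𝒞_{z″})_{D′}` over
`Spec D′`, the point equalities `hpt ∕ hpt″ ∕ e` (generic) and `hspt ∕ hspt″ ∕ et` (special) that feed the §1 isomorphisms, and: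
`U_{a′} = (E 𝒜)⁻¹ ≫ u ≫ (E″ 𝒞)` at `a′ = Spec Ω → Spec R → Spec D′`; `U` is the unique `D′`-morphism with that `Ω`-fibre; if `u` is an
isogeny, every fibre of `U` over `Spec D′` is.  (★ (ν5) `exists_finiteStage_hom_extension` at `A := 𝒜_z`, `C := 𝒞_{z″}` and the transported
`u`; ★ (ν3) `isIsogeny_hom_comp_iso`.) [cite: SerreTate1968, §1] [cite: BoschLutkebohmertRaynaud1990, §1.2 Prop. 8 and §7.3 Prop. 6 (p. 180)]
[cite: EGAIV3, Thm. 8.8.2 (i)] [cite: MumfordFogartyKirwan1994, Ch. 7 §2 Definition 7.2 (p. 129)] -/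
theorem exists_stage_hom_reduction
    (u : ((𝒜.baseChange (𝓨.genericIso'.inv.left ≫ pullback.fst 𝓨.total.hom (specGenericPoint (valuationSubringAtPrime K v) K))).fibre
            x.left).toAbelianVariety ⟶
         ((𝒞.baseChange (𝓨.genericIso'.inv.left ≫ pullback.fst 𝓨.total.hom (specGenericPoint (valuationSubringAtPrime K v) K))).fibre
            x''.left).toAbelianVariety) :
    ∃ (L' : Type) (_ : Field L') (_ : Algebra L L') (_ : Algebra D L') (_ : IsScalarTower D L L') (_ : Module.Finite L L')
      (χ : L' →ₐ[L] AlgebraicClosure (v.adicCompletion K))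
      (h' : integralClosure D L' →+* closureValuationSubring (v.adicCompletion K))
      (U : ((𝒜.baseChange z.left).baseChange (Spec.map (CommRingCat.ofHom (algebraMap D (integralClosure D L'))))).X ⟶
           ((𝒞.baseChange z''.left).baseChange (Spec.map (CommRingCat.ofHom (algebraMap D (integralClosure D L'))))).X)
      (_ : IsMonHom U)
      (hpt : x.left ≫ (𝓨.genericIso'.inv.left ≫ pullback.fst 𝓨.total.hom (specGenericPoint (valuationSubringAtPrime K v) K)) =
        (specGenericPoint (closureValuationSubring (v.adicCompletion K)) (AlgebraicClosure (v.adicCompletion K)) ≫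
          Spec.map (CommRingCat.ofHom h)) ≫ z.left)
      (hpt'' : x''.left ≫ (𝓨.genericIso'.inv.left ≫ pullback.fst 𝓨.total.hom (specGenericPoint (valuationSubringAtPrime K v) K)) =
        (specGenericPoint (closureValuationSubring (v.adicCompletion K)) (AlgebraicClosure (v.adicCompletion K)) ≫
          Spec.map (CommRingCat.ofHom h)) ≫ z''.left)
      (e : (specGenericPoint (closureValuationSubring (v.adicCompletion K)) (AlgebraicClosure (v.adicCompletion K)) ≫
            Spec.map (CommRingCat.ofHom h')) ≫ Spec.map (CommRingCat.ofHom (algebraMap D (integralClosure D L'))) =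
          specGenericPoint (closureValuationSubring (v.adicCompletion K)) (AlgebraicClosure (v.adicCompletion K)) ≫
            Spec.map (CommRingCat.ofHom h))
      (_hspt : (𝓨.geomReductionMap x).left ≫ pullback.fst 𝓨.total.hom (specResidueField v) =
        (((geomClosedPointIsoSpecResidueField v).inv.left ≫
          (specRingHomι (closureValuationSubring (v.adicCompletion K)) (toClosureValuationSubring v)
            (IsLocalRing.residue (closureValuationSubring (v.adicCompletion K)))).left) ≫ Spec.map (CommRingCat.ofHom h)) ≫ z.left)
      (_hspt'' : (𝓨.geomReductionMap x'').left ≫ pullback.fst 𝓨.total.hom (specResidueField v) =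
        (((geomClosedPointIsoSpecResidueField v).inv.left ≫
          (specRingHomι (closureValuationSubring (v.adicCompletion K)) (toClosureValuationSubring v)
            (IsLocalRing.residue (closureValuationSubring (v.adicCompletion K)))).left) ≫ Spec.map (CommRingCat.ofHom h)) ≫ z''.left)
      (_et : (((geomClosedPointIsoSpecResidueField v).inv.left ≫
          (specRingHomι (closureValuationSubring (v.adicCompletion K)) (toClosureValuationSubring v)
            (IsLocalRing.residue (closureValuationSubring (v.adicCompletion K)))).left) ≫ Spec.map (CommRingCat.ofHom h')) ≫
            Spec.map (CommRingCat.ofHom (algebraMap D (integralClosure D L'))) =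
          ((geomClosedPointIsoSpecResidueField v).inv.left ≫
          (specRingHomι (closureValuationSubring (v.adicCompletion K)) (toClosureValuationSubring v)
            (IsLocalRing.residue (closureValuationSubring (v.adicCompletion K)))).left) ≫ Spec.map (CommRingCat.ofHom h)),
      Function.Injective χ ∧
      (∀ x_1, ((h' x_1 : closureValuationSubring (v.adicCompletion K)) : AlgebraicClosure (v.adicCompletion K)) = χ (x_1 : L')) ∧
      h'.comp (algebraMap D (integralClosure D L')) = h ∧
      IsDedekindDomain (integralClosure D L') ∧ IsFractionRing (integralClosure D L') L' ∧
      -- the `Ω`-fibre of `U` IS `u`, through the along-stage isomorphisms of §1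
      fibreHom U (specGenericPoint (closureValuationSubring (v.adicCompletion K)) (AlgebraicClosure (v.adicCompletion K)) ≫
          Spec.map (CommRingCat.ofHom h')) =
        (𝒜.fibreBaseChangeIso _ x.left ≪≫ 𝒜.fibreCongrPtIso hpt ≪≫ (𝒜.fibreBaseChangeIso z.left _).symm ≪≫
            ((𝒜.baseChange z.left).fibreCongrPtIso e).symm ≪≫ ((𝒜.baseChange z.left).fibreBaseChangeIso _ _).symm).inv ≫ u ≫
        (𝒞.fibreBaseChangeIso _ x''.left ≪≫ 𝒞.fibreCongrPtIso hpt'' ≪≫ (𝒞.fibreBaseChangeIso z''.left _).symm ≪≫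
            ((𝒞.baseChange z''.left).fibreCongrPtIso e).symm ≪≫ ((𝒞.baseChange z''.left).fibreBaseChangeIso _ _).symm).hom ∧
      -- uniqueness of `U` given its `Ω`-fibre
      (∀ U' : ((𝒜.baseChange z.left).baseChange (Spec.map (CommRingCat.ofHom (algebraMap D (integralClosure D L'))))).X ⟶
           ((𝒞.baseChange z''.left).baseChange (Spec.map (CommRingCat.ofHom (algebraMap D (integralClosure D L'))))).X,
        (Over.pullback (specGenericPoint (closureValuationSubring (v.adicCompletion K)) (AlgebraicClosure (v.adicCompletion K)) ≫
            Spec.map (CommRingCat.ofHom h'))).map U' =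
          (Over.pullback (specGenericPoint (closureValuationSubring (v.adicCompletion K)) (AlgebraicClosure (v.adicCompletion K)) ≫
            Spec.map (CommRingCat.ofHom h'))).map U → U' = U) ∧
      -- isogenies reduce to isogenies (every fibre over the refined stage)
      (AbelianVariety.IsIsogeny u → ∀ {k : Type} [Field k] (tt : Spec (.of k) ⟶ Spec (.of (integralClosure D L'))),
        AbelianVariety.IsIsogeny (fibreHom U tt)) := by
  -- the two point equalities along the stage points (★ `left_specFractionFieldι_comp_extendPoint_modelPointsEquiv_symm` ∕
  -- ★ `left_geomReductionMap_comp_fst`, composed with `x̃ = Spec h ≫ z`)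
  have hptA : x.left ≫ (𝓨.genericIso'.inv.left ≫ pullback.fst 𝓨.total.hom (specGenericPoint (valuationSubringAtPrime K v) K)) =
      (specGenericPoint (closureValuationSubring (v.adicCompletion K)) (AlgebraicClosure (v.adicCompletion K)) ≫
        Spec.map (CommRingCat.ofHom h)) ≫ z.left := by
    rw [Category.assoc, hz]; exact (𝓨.left_specFractionFieldι_comp_extendPoint_modelPointsEquiv_symm x).symm
  have hptC : x''.left ≫ (𝓨.genericIso'.inv.left ≫ pullback.fst 𝓨.total.hom (specGenericPoint (valuationSubringAtPrime K v) K)) =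
      (specGenericPoint (closureValuationSubring (v.adicCompletion K)) (AlgebraicClosure (v.adicCompletion K)) ≫
        Spec.map (CommRingCat.ofHom h)) ≫ z''.left := by
    rw [Category.assoc, hz'']; exact (𝓨.left_specFractionFieldι_comp_extendPoint_modelPointsEquiv_symm x'').symm
  have hsptA : (𝓨.geomReductionMap x).left ≫ pullback.fst 𝓨.total.hom (specResidueField v) =
      (((geomClosedPointIsoSpecResidueField v).inv.left ≫
        (specRingHomι (closureValuationSubring (v.adicCompletion K)) (toClosureValuationSubring v)
          (IsLocalRing.residue (closureValuationSubring (v.adicCompletion K)))).left) ≫ Spec.map (CommRingCat.ofHom h)) ≫ z.left := by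
    rw [𝓨.left_geomReductionMap_comp_fst x, Category.assoc, Category.assoc, hz]
  have hsptC : (𝓨.geomReductionMap x'').left ≫ pullback.fst 𝓨.total.hom (specResidueField v) =
      (((geomClosedPointIsoSpecResidueField v).inv.left ≫
        (specRingHomι (closureValuationSubring (v.adicCompletion K)) (toClosureValuationSubring v)
          (IsLocalRing.residue (closureValuationSubring (v.adicCompletion K)))).left) ≫ Spec.map (CommRingCat.ofHom h)) ≫ z''.left := by
    rw [𝓨.left_geomReductionMap_comp_fst x'', Category.assoc, Category.assoc, hz'']
  -- the generic-fibre transports of §1 (first three pieces) and the transported `u`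
  let eA := 𝒜.fibreBaseChangeIso _ x.left ≪≫ 𝒜.fibreCongrPtIso hptA ≪≫ (𝒜.fibreBaseChangeIso z.left
    (specGenericPoint (closureValuationSubring (v.adicCompletion K)) (AlgebraicClosure (v.adicCompletion K)) ≫
      Spec.map (CommRingCat.ofHom h))).symm
  let eC := 𝒞.fibreBaseChangeIso _ x''.left ≪≫ 𝒞.fibreCongrPtIso hptC ≪≫ (𝒞.fibreBaseChangeIso z''.left
    (specGenericPoint (closureValuationSubring (v.adicCompletion K)) (AlgebraicClosure (v.adicCompletion K)) ≫
      Spec.map (CommRingCat.ofHom h))).symm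
  -- DESCEND-AND-EXTEND (★ (ν5))
  have H5 := exists_finiteStage_hom_extension (closureValuationSubring (v.adicCompletion K)) h hh _ ha
    (𝒜.baseChange z.left) (𝒞.baseChange z''.left) (eA.inv ≫ u ≫ eC.hom)
  obtain ⟨L', iF, iA, iAD, iT, iFin, χ, h', U, hUmon, e, hχinj, hh', hh'h, hDed, hFrac, hfib, huniq, hisog⟩ := H5
  have et : (((geomClosedPointIsoSpecResidueField v).inv.left ≫
      (specRingHomι (closureValuationSubring (v.adicCompletion K)) (toClosureValuationSubring v)
        (IsLocalRing.residue (closureValuationSubring (v.adicCompletion K)))).left) ≫ Spec.map (CommRingCat.ofHom h')) ≫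
        Spec.map (CommRingCat.ofHom (algebraMap D (integralClosure D L'))) =
      ((geomClosedPointIsoSpecResidueField v).inv.left ≫
      (specRingHomι (closureValuationSubring (v.adicCompletion K)) (toClosureValuationSubring v)
        (IsLocalRing.residue (closureValuationSubring (v.adicCompletion K)))).left) ≫ Spec.map (CommRingCat.ofHom h) := by
    rw [Category.assoc, ← Spec.map_comp, ← CommRingCat.ofHom_comp, hh'h]
  refine ⟨L', iF, iA, iAD, iT, iFin, χ, h', U, hUmon, hptA, hptC, e, hsptA, hsptC, et, hχinj, hh', hh'h, hDed, hFrac, ?_, huniq, ?_⟩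
  · -- the `Ω`-fibre clause: pure isomorphism algebra on ★ (ν5)'s clause
    have h1 := (Iso.eq_comp_inv _).mpr hfib
    rw [h1]
    simp only [eA, eC, Iso.trans_hom, Iso.trans_inv, Iso.symm_hom, Iso.symm_inv, Category.assoc]
  · intro hu k _ tt
    exact hisog (isIsogeny_hom_comp_iso eA.symm u eC hu) tt

end Head

end AbelianSchemeOver
end Literature.AlgebraicGeometry.AbelianSchemes

end
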